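import Summits.BirchSwinnertonDyer.BirchSwinnertonDyer.Theorems.SignedLowerHalvesSprungLowerDivisibilityAtThreeRobustBezoutSplit
import HarnessLib

/-!
# Crux `SprungLowerDivisibilityAtThree` (K1, item stmt-BirchSwinnertonDyer-19875), line `chromatic-common-zeros`:
# the DEGREE-SPLIT door on exact Mazur–Tate data — per-degree weighted certificates and a top-degree DIVISION certificate (RB0-MT-split)

Cell `bsd-ssimc` (host), width seat `cruxlead-stmt-BirchSwinnertonDyer-19875-w2` (g4) under the 19875 lead; `--supports` 19875
`--as helper`; THEOREMS ONLY; closes NO item. K1, BSD and leaf X8 are NOT proved by anything here; every per-pair hypothesis is a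
displayed DATUM (exact rational / integer data of the Mazur–Tate elements `θ_n`).

## What is proved

* §1 (general `p ∣ a_p`, `p ≠ 2`; namespace `…ChromaticCommonZeros`): **`mem_span_sup_of_mazurTate_sum`** — the weighted multi-layer
  transfer with an ARBITRARY target: if `a_n·ω_n ∈ J` (`n ∈ s`), `E ∈ J` and `ι E = Σ_{n∈s} a_n·θ_n − ι t`, then `t ∈ (L♯, L♭) + J`
  (generalises `exists_gradedBezout_of_mazurTate_sum`, target `t = C(p^k)`); `coeff_toIwasawa_eq_zero_of_natDegree_lt`,
  `int_pow_dvd_coeff_of_C_pow_dvd_toIwasawa` (plumbing for an integer remainder `R₀`).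
* §2 (X8): **(RB0-MT-split) `sprungSharpFlatLowerDivisibility_of_mazurTateSplit`** — per newform: one `λ`-reading layer (`μ(L^•) = 0`,
  `λ(L^•) = l`); for each degree `1 ≤ d < l` a weighted multi-layer certificate w.r.t. `J_d = (p, T^d)` (`d ≤ p^{j_d}`, weights
  `p^{k_d+j_d−n−⌊i/d⌋} ∣ a_{n,i}`, `E_d ∈ J_d^{k_d+1}`, `ι E_d = Σ a_n θ_n − p^{k_d}`); and for the top degree `l` EITHER the same w.r.t. `J_l`
  OR a DIVISION certificate (`1 ≤ m`, `l ≤ p^j`, weights `p^{(m−1)+j−n−⌊i/l⌋} ∣ a_{n,i}`, `E ∈ J_l^m`, an integer polynomial `R₀` of degree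
  `< l` with `ι E = Σ a_n θ_n − R₀` and SOME coefficient of `R₀` not divisible by `p^m`) ⟹ `Theorems.SprungSharpFlatLowerDivisibility W p col`
  for BOTH colours (`ChromaticRobustBezout.natCast_mem_of_splitCert` + S3 at `(p)` + R0). CONDITIONAL on `h714`, `h3`, `hJ`.
  Data probe (x8 census, θ-records n ≤ 5/6): 74/215 cells vs 66/215 for the single-ideal form. Nothing is asserted about any curve.

References: [Sprung2012] Thm. 7.14 (3), Prop. 7.19; [Sprung2017] Thm. 1.12, Cor. 4.4, 4.10; [Pollack2003] Prop. 6.9, 6.10, 6.18;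
[Washington1997] §7.1, §13.2; tree: `…RobustBezoutSplit`, `…RobustBezoutMTLayers` (p633487), `…RobustBezoutDoor` (p630933).
-/

set_option autoImplicit false
-- justification: the mandated namespace `Summit.BirchSwinnertonDyer.BirchSwinnertonDyer.Theorems`
-- (single-conjunct summit, Sub = Summit) repeats a segment by design (D-0017).
set_option linter.dupNamespace false

noncomputable section

open scoped Classical NumberField MatrixGroups ModularForm Polynomial

open NumberField IsDedekindDomain CongruenceSubgroup WeierstrassCurve Field Polynomial
  Literature.NumberTheory.EllipticCurves Literature.NumberTheory.EllipticCurves.ModularForms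
  Literature.NumberTheory.EllipticCurves.ZpExtension Literature.NumberTheory.EllipticCurves.Sprung2017
  Literature.NumberTheory.EllipticCurves.Sprung2012 Literature.NumberTheory.EllipticCurves.Rank1Residual
  Literature.NumberTheory.EllipticCurves.IwasawaAlgebra
  Summit.BirchSwinnertonDyer.BirchSwinnertonDyer.Theorems
  Summit.BirchSwinnertonDyer.Rank1Residual.Supersingular
  Summit.BirchSwinnertonDyer.Rank1Residual.X1.MuLambda
  Summit.BirchSwinnertonDyer.Rank1Residual.Iwasawa
  Summit.BirchSwinnertonDyer.BirchSwinnertonDyer.Theorems.ChromaticSlopeSeparation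

namespace Summit.BirchSwinnertonDyer.BirchSwinnertonDyer.Theorems.ChromaticCommonZeros

open Summit.BirchSwinnertonDyer.BirchSwinnertonDyer.Theorems.ChromaticRobustBezout

/-! ### §1 The weighted transfer with an arbitrary target; integer remainders -/
section TransferTarget

variable {W : WeierstrassCurve ℚ} [W.IsElliptic] [W.IsGloballyMinimal] {N : ℕ} [NeZero N]
  {f : CuspForm (Gamma0 N) 2} {p : ℕ} [hp : Fact p.Prime]

/-- **Weighted multi-layer transfer, arbitrary target.** For a Sprung pair, an ideal `J`, layers `s` with weights `a_n ∈ ℤ[T]` such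
that `a_n·ω_n ∈ J`, and `t ∈ Λ`: if `Σ_{n∈s} a_n·θ_n − ι t = ι E` with `E ∈ J`, then `t ∈ (L♯, L♭) + J` — since
`Σ a_n Θ_n = Σ a_n ω_n Q_n − (Σ a_n u_n) L♯ − (Σ a_n v_n) L♭` for the integral `Θ_n`. [cite: Sprung2017, Thm. 1.12, Cor. 4.4, Cor. 4.10] -/
theorem mem_span_sup_of_mazurTate_sum (hp2 : p ≠ 2) (hf : IsNewformOf W f)
    (hgood : W.HasGoodReductionAtPrime p) (hap : (p : ℤ) ∣ W.frobeniusTrace p)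
    {Lsharp Lflat : IwasawaAlgebra p} (hSP : IsSprungPair f p (W.frobeniusTrace p) Lsharp Lflat)
    (J : Ideal (IwasawaAlgebra p)) (s : Finset ℕ) (a : ℕ → ℤ[X])
    (hω : ∀ n ∈ s, toIwasawa p (a n) * toIwasawa p (cyclotomicOmega p n) ∈ J)
    {E t : IwasawaAlgebra p} {T : ℚ[X]} (hE : E ∈ J)
    (ht : iwasawaToPowerSeries p t = ((T.map (algebraMap ℚ ℚ_[p]) : ℚ_[p][X]) : PowerSeries ℚ_[p]))
    (hR : iwasawaToPowerSeries p E =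
      ((((∑ n ∈ s, (a n).map (Int.castRingHom ℚ) * mazurTateElement f p n) - T).map
        (algebraMap ℚ ℚ_[p]) : ℚ_[p][X]) : PowerSeries ℚ_[p])) :
    t ∈ Ideal.span {Lsharp, Lflat} ⊔ J := by
  choose Q hQ using fun n => exists_integral_mazurTate_of_isSprungPair hp2 hf hgood hap hSP n
  set u : ℕ → IwasawaAlgebra p := fun n => toIwasawa p (sharpPoly (W.frobeniusTrace p) p n) with hu
  set v : ℕ → IwasawaAlgebra p := fun n => toIwasawa p (flatPoly (W.frobeniusTrace p) p n) with hv
  have hι : iwasawaToPowerSeries p ((∑ n ∈ s, toIwasawa p (a n) *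
      (toIwasawa p (cyclotomicOmega p n) * Q n - (u n * Lsharp + v n * Lflat))) - t) = iwasawaToPowerSeries p E := by
    rw [hR, map_sub, map_sum, ht, Polynomial.map_sub, Polynomial.coe_sub, Polynomial.map_sum, coe_finset_sum]
    congr 1
    refine Finset.sum_congr rfl fun n _ => ?_
    rw [map_mul, iwasawaToPowerSeries_toIwasawa_eq, hu, hv, ← hQ n, Polynomial.map_mul, Polynomial.coe_mul]
  have heq := iwasawaToPowerSeries_injective p hι
  have h2 : (∑ n ∈ s, toIwasawa p (a n) * (toIwasawa p (cyclotomicOmega p n) * Q n - (u n * Lsharp + v n * Lflat))) =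
      (∑ n ∈ s, toIwasawa p (a n) * toIwasawa p (cyclotomicOmega p n) * Q n) -
        (∑ n ∈ s, toIwasawa p (a n) * u n) * Lsharp - (∑ n ∈ s, toIwasawa p (a n) * v n) * Lflat := by
    simp only [mul_sub, mul_add, Finset.sum_sub_distrib, Finset.sum_add_distrib, Finset.sum_mul, mul_assoc]
    ring
  have h1 : t = (-(∑ n ∈ s, toIwasawa p (a n) * u n) * Lsharp + -(∑ n ∈ s, toIwasawa p (a n) * v n) * Lflat) +
      ((∑ n ∈ s, toIwasawa p (a n) * toIwasawa p (cyclotomicOmega p n) * Q n) - E) := by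
    rw [← heq, h2]; ring
  rw [h1]
  refine Ideal.add_mem _ (Ideal.mem_sup_left ?_) (Ideal.mem_sup_right ?_)
  · rw [Ideal.mem_span_insert]
    exact ⟨_, _, Ideal.mem_span_singleton'.mpr ⟨_, rfl⟩, rfl⟩
  · exact Ideal.sub_mem _ (Ideal.sum_mem _ fun n hn => Ideal.mul_mem_right _ _ (hω n hn)) hE

/-- An integer polynomial of degree `< l` has vanishing coefficients of index `≥ l` in `Λ`. [folklore] -/
theorem coeff_toIwasawa_eq_zero_of_natDegree_lt (R₀ : ℤ[X]) {l i : ℕ} (hR : R₀.natDegree < l) (hi : l ≤ i) :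
    PowerSeries.coeff i (toIwasawa p R₀) = 0 := by
  rw [toIwasawa_apply, Polynomial.coeff_coe, Polynomial.coeff_map, Polynomial.coeff_eq_zero_of_natDegree_lt (by omega), map_zero]

/-- If `C(p^m) ∣ R₀` in `Λ` for an integer polynomial `R₀`, then `p^m` divides every integer coefficient of `R₀`. [folklore] -/
theorem int_pow_dvd_coeff_of_C_pow_dvd_toIwasawa (R₀ : ℤ[X]) {m : ℕ}
    (h : (PowerSeries.C ((p : ℤ_[p]) ^ m) : IwasawaAlgebra p) ∣ toIwasawa p R₀) (i : ℕ) : ((p : ℤ) ^ m) ∣ R₀.coeff i := by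
  obtain ⟨D, hD⟩ := h
  have hc : ((R₀.coeff i : ℤ) : ℤ_[p]) = (p : ℤ_[p]) ^ m * PowerSeries.coeff i D := by
    have h1 := congrArg (PowerSeries.coeff i) hD
    rw [toIwasawa_apply, Polynomial.coeff_coe, Polynomial.coeff_map, PowerSeries.coeff_C_mul] at h1
    simpa using h1
  have hmem : ((R₀.coeff i : ℤ) : ℤ_[p]) ∈ Ideal.span {(p : ℤ_[p]) ^ m} :=
    Ideal.mem_span_singleton'.mpr ⟨PowerSeries.coeff i D, by rw [hc, mul_comm]⟩
  rw [← PadicInt.norm_le_pow_iff_mem_span_pow] at hmem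
  exact PadicInt.norm_int_le_pow_iff_dvd.mp hmem

end TransferTarget

/-! ### §2 (RB0-MT-split): the X8 door -/
section SplitDoor

variable (W : WeierstrassCurve ℚ) [W.IsElliptic] [W.IsGloballyMinimal] (p : ℕ) [hp : Fact p.Prime]

/-- **(RB0-MT-split) K1 FOR BOTH COLOURS FROM PER-DEGREE MAZUR–TATE CERTIFICATES AND A TOP-DEGREE DIVISION CERTIFICATE.** On an X8 pair,
suppose that for (every) newform `f` of `W`: a `λ`-reading layer gives `μ(L^•) = 0`, `λ(L^•) = l` for a colour `•` (odd layer for `♯`,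
even for `♭`); for every degree `1 ≤ d < l` a weighted multi-layer certificate w.r.t. `(p, T^d)` is given; and for the top degree `l`
either such a certificate w.r.t. `(p, T^l)` or a DIVISION certificate (weights of exponent `m−1`, an integer remainder `R₀` of degree
`< l` with `ι E = Σ a_n θ_n − R₀`, `E ∈ (p, T^l)^m`, and some coefficient of `R₀` not divisible by `p^m`). Then
`Theorems.SprungSharpFlatLowerDivisibility W p col` holds for EVERY colour: at `(p)` S3; off `(p)` a common height-one prime has
some degree `d ≤ l` and is excluded by the degree-`d` certificate resp. (degree `l`) by `L^• ∤ L^{other}`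
(`ChromaticRobustBezout.natCast_mem_of_splitCert`); R0 concludes. CONDITIONAL on `h714`, `h3`, `hJ`; all per-pair inputs are exact
rational/integer data. Nothing is asserted about any curve. [cite: Sprung2012, Thm. 7.14 (3) (p. 1504), Prop. 7.19 (p. 1505)]
[cite: Sprung2017, Thm. 1.12, Cor. 4.4, Cor. 4.10] [cite: Pollack2003, Prop. 6.9, 6.10, 6.18] [cite: Washington1997, §7.1, §13.2] -/
theorem sprungSharpFlatLowerDivisibility_of_mazurTateSplit
    (h714 : thm714_sharpFlatSelmerDual_finite_torsion) (h3 : realPeriodRat_eq_unit_mul_plusPeriod_three)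
    (hJ : thm714seq_sharpFlatColemanKato_zetaJoint) (hX : ClassX8 W p)
    (hcert : ∀ {N : ℕ} [NeZero N] (f : CuspForm (Gamma0 N) 2), IsNewformOf W f →
      ∃ (n₀ l : ℕ) (Θ₀ : IwasawaAlgebra p),
        iwasawaToPowerSeries p Θ₀ = ((mazurTateElement f p n₀).map (algebraMap ℚ ℚ_[p]) : PowerSeries ℚ_[p]) ∧
        Θ₀ ≠ 0 ∧ mu Θ₀ = 0 ∧
        ((Odd n₀ ∧ lam Θ₀ = (cyclotomicOmegaPlus p n₀).natDegree + l) ∨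
          (Even n₀ ∧ lam Θ₀ = (cyclotomicOmegaMinus p n₀).natDegree + l)) ∧
        (∀ d, 1 ≤ d → d < l → ∃ (j k : ℕ) (s : Finset ℕ) (a : ℕ → ℤ[X]) (E : IwasawaAlgebra p),
          d ≤ p ^ j ∧ (∀ n ∈ s, ∀ i, (p : ℤ) ^ (k + j - n - i / d) ∣ (a n).coeff i) ∧
          E ∈ (Ideal.span {(PowerSeries.C (p : ℤ_[p]) : IwasawaAlgebra p), PowerSeries.X ^ d}) ^ (k + 1) ∧
          iwasawaToPowerSeries p E =
            ((((∑ n ∈ s, (a n).map (Int.castRingHom ℚ) * mazurTateElement f p n) - Polynomial.C ((p : ℚ) ^ k)).map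
              (algebraMap ℚ ℚ_[p]) : ℚ_[p][X]) : PowerSeries ℚ_[p])) ∧
        ((∃ (j k : ℕ) (s : Finset ℕ) (a : ℕ → ℤ[X]) (E : IwasawaAlgebra p),
          l ≤ p ^ j ∧ (∀ n ∈ s, ∀ i, (p : ℤ) ^ (k + j - n - i / l) ∣ (a n).coeff i) ∧
          E ∈ (Ideal.span {(PowerSeries.C (p : ℤ_[p]) : IwasawaAlgebra p), PowerSeries.X ^ l}) ^ (k + 1) ∧
          iwasawaToPowerSeries p E =
            ((((∑ n ∈ s, (a n).map (Int.castRingHom ℚ) * mazurTateElement f p n) - Polynomial.C ((p : ℚ) ^ k)).map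
              (algebraMap ℚ ℚ_[p]) : ℚ_[p][X]) : PowerSeries ℚ_[p])) ∨
         (∃ (j m : ℕ) (s : Finset ℕ) (a : ℕ → ℤ[X]) (E : IwasawaAlgebra p) (R₀ : ℤ[X]),
          1 ≤ m ∧ l ≤ p ^ j ∧ (∀ n ∈ s, ∀ i, (p : ℤ) ^ (m - 1 + j - n - i / l) ∣ (a n).coeff i) ∧
          E ∈ (Ideal.span {(PowerSeries.C (p : ℤ_[p]) : IwasawaAlgebra p), PowerSeries.X ^ l}) ^ m ∧
          iwasawaToPowerSeries p E =
            ((((∑ n ∈ s, (a n).map (Int.castRingHom ℚ) * mazurTateElement f p n) - R₀.map (Int.castRingHom ℚ)).map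
              (algebraMap ℚ ℚ_[p]) : ℚ_[p][X]) : PowerSeries ℚ_[p]) ∧
          R₀.natDegree < l ∧ ∃ i, ¬ ((p : ℤ) ^ m) ∣ R₀.coeff i)))
    (col : Chroma) : SprungSharpFlatLowerDivisibility W p col := by
  refine sprungSharpFlatLowerDivisibility_of_noCommonZero W p h714 h3 hJ hX ?_ col
  intro N hN f ϖ Lsharp Lflat hf hϖ hSP 𝔭 h𝔭
  obtain ⟨hp3, ⟨hgood, hap⟩, -⟩ := id hX
  subst hp3
  by_cases hp𝔭 : ((3 : ℕ) : IwasawaAlgebra 3) ∈ 𝔭.asIdeal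
  · exact X8.exists_normalised_notMem_of_natCast_mem W 3 h3 hX hf hϖ hSP 𝔭 h𝔭 hp𝔭
  have hp2 : (3 : ℕ) ≠ 2 := by decide
  obtain ⟨n₀, l, Θ₀, hΘ₀, hΘ₀0, hμΘ₀, hread, hlow, htop⟩ := hcert f hf
  obtain ⟨hs0, hf0⟩ :=
    ChromaticBothColours.ClassX8.sharp_ne_zero_and_flat_ne_zero W 3 hX N hN f Lsharp Lflat hf hSP
  -- the colour `F` carrying the `λ`-reading, and the other colour `G`
  obtain ⟨F, G, hFG, hF0, hμF, hlF⟩ : ∃ F G : IwasawaAlgebra 3, Ideal.span {F, G} = Ideal.span {Lsharp, Lflat} ∧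
      F ≠ 0 ∧ mu F = 0 ∧ lam F = l := by
    rcases hread with ⟨hodd, hlam⟩ | ⟨heven, hlam⟩
    · obtain ⟨hμ, hl'⟩ := lam_sharp_eq_of_mazurTate' hp2 hf hgood hap hSP hodd hΘ₀ hΘ₀0 hμΘ₀ hlam
      exact ⟨Lsharp, Lflat, rfl, hs0, hμ, hl'⟩
    · obtain ⟨hμ, hl'⟩ := lam_flat_eq_of_mazurTate' hp2 hf hgood hap hSP heven hΘ₀ hΘ₀0 hμΘ₀ hlam
      refine ⟨Lflat, Lsharp, ?_, hf0, hμ, hl'⟩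
      simp only [Ideal.span_insert, sup_comm]
  -- weights ⇒ `a_n ω_n ∈ J_d^{k+1}`; MT transfer ⇒ membership certificates in `(L♯, L♭) + J`
  have transfer : ∀ (d j k : ℕ) (s : Finset ℕ) (a : ℕ → ℤ[X]) (E : IwasawaAlgebra 3), d ≤ 3 ^ j →
      (∀ n ∈ s, ∀ i, (3 : ℤ) ^ (k + j - n - i / d) ∣ (a n).coeff i) →
      E ∈ (Ideal.span {(PowerSeries.C ((3 : ℕ) : ℤ_[3]) : IwasawaAlgebra 3), PowerSeries.X ^ d}) ^ (k + 1) →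
      ∀ {t : IwasawaAlgebra 3} {T : ℚ[X]},
        iwasawaToPowerSeries 3 t = ((T.map (algebraMap ℚ ℚ_[3]) : ℚ_[3][X]) : PowerSeries ℚ_[3]) →
        iwasawaToPowerSeries 3 E =
          ((((∑ n ∈ s, (a n).map (Int.castRingHom ℚ) * mazurTateElement f 3 n) - T).map
            (algebraMap ℚ ℚ_[3]) : ℚ_[3][X]) : PowerSeries ℚ_[3]) →
        t ∈ Ideal.span {F, G} ⊔ (Ideal.span {(PowerSeries.C ((3 : ℕ) : ℤ_[3]) : IwasawaAlgebra 3), PowerSeries.X ^ d}) ^ (k + 1) := by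
    intro d j k s a E hdj ha hE t T ht hR
    rw [hFG]
    refine mem_span_sup_of_mazurTate_sum hp2 hf hgood hap hSP _ s a (fun n hn => ?_) hE ht hR
    exact weight_mul_cyclotomicOmega_mem (p := 3) hdj (toIwasawa_mem_certIdeal_pow_of_dvd (p := 3) (a n) (ha n hn))
  have hCpk : ∀ k : ℕ, iwasawaToPowerSeries 3 (PowerSeries.C (((3 : ℕ) : ℤ_[3]) ^ k)) =
      (((Polynomial.C (((3 : ℕ) : ℚ) ^ k)).map (algebraMap ℚ ℚ_[3]) : ℚ_[3][X]) : PowerSeries ℚ_[3]) :=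
    fun k => iwasawaToPowerSeries_C_natCast_pow k
  -- assemble the split certificate for `(F, G)`
  have hmain := natCast_mem_of_splitCert (p := 3) (F := F) (G := G) hF0 hμF ?_ ?_ 𝔭 h𝔭
  rotate_left
  · intro d hd1 hdl
    rw [hlF] at hdl
    obtain ⟨j, k, s, a, E, hdj, ha, hE, hR⟩ := hlow d hd1 hdl
    exact ⟨k, transfer d j k s a E hdj ha hE (hCpk k) hR⟩
  · rw [hlF]
    rcases htop with ⟨j, k, s, a, E, hlj, ha, hE, hR⟩ | ⟨j, m, s, a, E, R₀, hm1, hlj, ha, hE, hR, hdeg, i₀, hi₀⟩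
    · exact Or.inl ⟨k, transfer l j k s a E hlj ha hE (hCpk k) hR⟩
    · refine Or.inr ⟨m, toIwasawa 3 R₀, ?_, fun i hi => coeff_toIwasawa_eq_zero_of_natDegree_lt R₀ hdeg hi,
        fun hdvd => hi₀ (int_pow_dvd_coeff_of_C_pow_dvd_toIwasawa R₀ hdvd i₀)⟩
      obtain ⟨k, rfl⟩ : ∃ k, m = k + 1 := ⟨m - 1, by omega⟩
      have ha' : ∀ n ∈ s, ∀ i, (3 : ℤ) ^ (k + j - n - i / l) ∣ (a n).coeff i := by
        intro n hn i; have h := ha n hn i; rwa [Nat.add_sub_cancel] at h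
      exact transfer l j k s a E hlj ha' hE (iwasawaToPowerSeries_toIwasawa_eq R₀) hR
  -- some colour misses `𝔭`
  have hmiss : ∃ col' : Chroma, chromaticL col' Lsharp Lflat ∉ 𝔭.asIdeal := by
    by_contra hall
    push Not at hall
    have hboth : F ∈ 𝔭.asIdeal ∧ G ∈ 𝔭.asIdeal := by
      have hle : Ideal.span {F, G} ≤ 𝔭.asIdeal := by
        rw [hFG, Ideal.span_insert, sup_le_iff, Ideal.span_singleton_le_iff_mem, Ideal.span_singleton_le_iff_mem]
        exact ⟨by simpa using hall Chroma.sharp, by simpa using hall Chroma.flat⟩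
      exact ⟨hle (Ideal.subset_span (by simp)), hle (Ideal.subset_span (by simp))⟩
    exact hp𝔭 (hmain hboth.1 hboth.2)
  obtain ⟨col', hcol'⟩ := hmiss
  exact X8.exists_normalised_notMem_of_notMem W 3 h3 hX hf hϖ 𝔭 hcol'

end SplitDoor

end Summit.BirchSwinnertonDyer.BirchSwinnertonDyer.Theorems.ChromaticCommonZeros

end
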